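import Summits.HodgeConjecture.HodgeConjecture.Cruxes.BlochSeedDiscOne.SeedChecker
import Literature.AlgebraicGeometry.HodgeTheory.ExpTwistClassesExponentialLaw

/-!
# `Cruxes/BlochSeedDiscOne/SeedCheckerWords.lean` — SEED CHECKER v10 (§13): the word frame of `S⁴` CONSTRUCTED, law (F1) PROVED

`line stmt-HodgeConjecture-18881 Cruxes/BlochSeedDiscOne/Lines/birth.lean 814a6a70c14e831a stub_rung_pad4_seedAt` · explicit unit
`hsemireg-c5c8-1` (g9; director MINT A5: C5–C8 typed as predicates on (design json, presentation)) · **a SATELLITE IN THE v4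
NAMESPACE** `Summit.HodgeConjecture.HodgeConjecture.Cruxes.BlochSeedDiscOne.SeedChecker` — it imports and extends `SeedChecker.lean`
v4 (`13437bb9848c3c36`, the only built member of the family) plus ONE built Literature file, and it does NOT import the unbuilt
satellites v5 `SeedCheckerPorteous`, v6.2 `SeedCheckerKit`, v7.1 `SeedCheckerFrame`, v8 `SeedCheckerBalanced`, v9 `SeedCheckerDescent`
(their farm snapshot is stale: `lean check` rc 75 `unbuilt` at 2026-08-30T00:45Z) and redeclares none of their names.

HONEST FRAMING (mandatory). Nothing in this file is a theorem toward HC, HC_CM, HC_AV, №4, `stmt-HodgeConjecture-26512`,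
`stmt-HodgeConjecture-18881` or H2, and nothing here touches the stub `stub_rung_pad4_seedAt` (never weakened, never restated).
What is PROVED is singular-cohomology bookkeeping on the anchor `S⁴ = pad4Anchor E₀`: the Künneth ∕ binomial identity behind
obligation **O-WF** ("a word frame linked to the Weil frame exists", v4 §6.2, v7.1 §10.9). Every (A1) ∕ C6 reading of the seed
checker so far (v4 `classCheck_iff_coords`, v6.2 (K3), v7.1 `bottomRow_iff_period_of_frame`, v9 `descent_checklist`) carried that as
the HYPOTHESIS `Φ.LinksTo F h`; v10 constructs `Φ` and proves its law (F1). It is a typed, sorry-free construction + evidence, not a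
rung, and it certifies no cycle.

WHAT v10 TYPES AND PROVES (all names new; `e ē` are PARAMETERS — two degree-one classes on `S = weilSurf E₀`):
* §13.1 divided powers `divPow X h k = hᵏ∕k!`, naturality `map_divPow`, and the BINOMIAL LAW `divPow_add :
  (b + c)^[k] = Σ_{i ≤ k} b^[i] ∪ c^[k−i]`, obtained from the tree's exponential law `expTwistClasses_add` (`e^{b+c} ∪ κ =
  e^{b} ∪ (e^{c} ∪ κ)`, [cite: HuybrechtsStellari2005, §1]) read against the unit family (`expTwistClasses_cupPowTwo_zero :
  e^{a} ∪ (1, 0, 0, …) = a^[·]`).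
* §13.2 the exterior product `famCross κ ν` of two total even families across `B × C`, `famCross_divPow : h_B^[·] ⊠ h_C^[·] =
  (pr₁^*h_B + pr₂^*h_C)^[·]`, bilinearity `famCross_sum_sum`, concentration ∕ truncation vanishing, the single surviving term.
* §13.3 the letter families `letterFam` of pad4lib's `LETTERS = (1, u, v, e, ē, p)`, `DEG = (0,1,1,1,1,2)` with `u = pr₁^*η`,
  `v = pr₂^*η`, `p = u ∪ v`, and the LETTER LAW `sum_letterFam : Σ_{l ∉ {e, ē}} ℓ(l)_j = h_S^[j]` for all `j` (`h_S = u + v`;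
  i.e. `exp(h_S) = 1 + (u + v) + p`, using only `dim E₀ = 1`: `η² = 0`).
* §13.4 the word classes `frameCls4 w = ℓ(w₀) ⊠ ℓ(w₁) ⊠ ℓ(w₂) ⊠ ℓ(w₃)` nested EXACTLY as `pad4Anchor E₀ = ((S × S) × S) × S`, the
  generic TOWER STEP `tower_step` (words on `m + 2` factors ≃ (word, last letter) by `Fin.snocEquiv`; bilinearity; letter law;
  `famCross_divPow`), the laws at levels 1–4 — `frameCls4_law : Σ_{w e-free} cls(w)_p = h_std^[p]` with `h_std = hStd E₀ η` of v4
  §2 ON THE NOSE (`hPad2 ∕ hPad3 ∕ hStd` unfold to the tower's `pr₁^* _ + pr₂^* h_S`) — concentration `frameCls4_eq_zero`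
  (`cls(w)` lives in degree `wdeg w`), the word frame `wordFrameOf η e ē : WordFrame E₀`, and
  **(F1) `wordFrameOf_sum_eFree : ∀ p : Fin 9, Σ_{w ∈ eFreeWordsOfDeg p} cls p w = (p!)⁻¹ • h_std^p`** — LITERALLY the field
  `WordFrame.LinksTo.sum_eFree` of v4 §6.2 (`#print axioms`: `propext, Classical.choice, Quot.sound`).
* §13.5 `wordFrameOf_cls_eWord : cls 4 eeee = e ⊠ e ⊠ e ⊠ e =: eeeeOf e`, `wordFrameOf_cls_ebarWord : cls 4 ēēēē = eeeeOf ē`, and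
  `wordFrameOf_linksTo`: the word frame LINKS (v4 `WordFrame.LinksTo`, with `h = h_std`) to every Weil frame `F : WeilFrame E₀ ψ₀`
  with `F.rOne = eeeeOf e + eeeeOf ē`, `F.rTwo = i • (eeeeOf e − eeeeOf ē)` — (F2) is the hypothesis, (F1) the theorem.

DICTIONARY TO v7.1 (not importable today; each identity is `rfl` in any file importing both, the bodies being verbatim copies):
`xstep = SeedCheckerFrame.cross`, `eeeeOf (eLetter ψ₀ v) = eeee ψ₀ v`, `eeeeOf (ebarLetter ψ₀ v) = eeeeBar ψ₀ v`. Hence, with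
`e := eLetter ψ₀ v`, `ē := ebarLetter ψ₀ v`, `F := normalisedFrame hE hψ hv hv0` (v7.1 §10.6; `normalisedFrame_rOne ∕ _rTwo` are
`rfl`), the one-liner `wordFrameOf_linksTo η _ _ hE (normalisedFrame hE hψ hv hv0) normalisedFrame_rOne normalisedFrame_rTwo` —
equivalently v7.1 §10.9 `WordFrame.linksTo_normalisedFrame hv hv0 (wordFrameOf η _ _) (hStd E₀ η) (wordFrameOf_sum_eFree η _ _ hE)
(wordFrameOf_cls_eWord η _ _) (wordFrameOf_cls_ebarWord η _ _)` — proves `(wordFrameOf η (eLetter ψ₀ v) (ebarLetter ψ₀ v)).LinksTo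
(normalisedFrame hE hψ hv hv0) (hStd E₀ η)`: for every rational `0 ≠ v ∈ H¹(E₀(ℂ))` THERE IS a word frame linked to the normalised
Weil frame with `h = h_std`, i.e. O-WF. That line waits only on a farm snapshot containing v7.1; it is RECORDED here, not claimed.

C5–C8 LEDGER (cumulative g0–g9; v10 changes only the status of the frame hypothesis in C6 ∕ C7):
* C5 (σ Hodge-class check at the seed) — design half = C0 (`μ ≠ 0`; v4 §7), presentation half vacuous GIVEN C1–C3 (v4, v6.2).
* C6 ((A1)-cleanliness AT THE SEED `Z`) — reads, by v4 `classCheck_iff_coords` ∕ v7.1 `bottomRow_iff_period_of_frame`, as pad4lib's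
  bottom-row test on the design json + the period test `t_Z = t(μ)` on the presentation, UNDER (F1)+(F2). v10 makes (F1) a
  theorem and (F2) the `rfl` dictionary above, so the frame hypothesis `Φ.LinksTo F h_std` of those readings is CONSTRUCTIBLE (modulo
  the joint import): C6 is a predicate on (design json `wt`, presentation `Z`) with no frame hypothesis left over. Purity caveat
  (critic idea-crit-6 n1, on v9 `ClassCheckFree`): identifying `cl(Z)` with `q • h⁴ + w` in `H⁸(S⁴(ℂ); ℚ)` uses that `cl(Z)` is a
  RATIONAL class of PURE type `(4,4)` (the cycle class of an algebraic cycle) — that is why its coordinates are read in the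
  `(p,p)`-part `ℚ h⁴ ⊕ W_K` at all; v10 does not alter that reading and assumes nothing further about `Z`.
* C7 (pad4-tower compatibility) — the nesting of `pad4Anchor` is matched factor-for-factor by `frameCls4` (`Fin.init ∕ Fin.last` peel
  the LAST factor = `AbelianVariety.snd`, as `pad4Action`, `hStd`, v7.1 `cross` do), and `eeeeOf` is v7.1's `eeee` by `rfl`:
  compatibility is definitional, not a hypothesis — vacuous as a separate check (implied by C0–C4's typing).
* C8 (disc-one) — vacuous per design: `HasHyperbolicBlochSeed 4 1` fixes `d = 1`; the `(4,1)` arithmetic (pencil `m = X² + 1054·X +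
  5⁸`, v4 §3 ∕ §8) is data of the design json, checked there numerically (v4's `wt` tables), not a predicate on `Z`.

HOUSE RULES honoured: no `sorry`; no `instance`, no `notation` ∕ `macro`, no attribute removal, no `set_option
allowUnsafeReducibility`; no new `Prop`-valued definitions (the e-free predicates are spelled inline, `EFree` is v4's);
`noncomputable section` opened at the top and CLOSED by the final `end` (critic n2); every declaration name is new and none of
v4–v9's names (`cross`, `eeee`, `eLetter`, `normalisedFrame`, …) is redeclared (critic n3: "satellite in the v4 namespace", said above).

References: [cite: HatcherAT2002, §3.2] (cup product; the Künneth formula = Thm. 3.15 of the online edition held as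
`book:hatchernd-algebraic-topology` p0277, Thm. 3.16 of the 2002 printing; Prop. 3.10 naturality; Thm. 3.11 graded commutativity);
[cite: HuybrechtsStellari2005, §1] (`exp(B)`-twisted classes, the exponential law); [cite: vanGeemen1994HodgeAV, Thm. 6.12 and its
proof] (Weil classes on fourfolds of `E⁴`-type; the `(e, ē)` eigenframe); [cite: Fulton1998, Thm. 14.4 and Ex. 14.4.1] (where (F1) ∕
(F2) are consumed downstream: v5 Porteous, v9 descent).
-/

noncomputable section

set_option linter.dupNamespace false

open CategoryTheory AlgebraicGeometry
open Literature.AlgebraicGeometry Literature.AlgebraicGeometry.Motives Literature.AlgebraicGeometry.HodgeTheory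
open Literature.AlgebraicTopology.SingularHomology

namespace Summit.HodgeConjecture.HodgeConjecture.Cruxes.BlochSeedDiscOne.SeedChecker

open Summit.HodgeConjecture.HodgeConjecture.Cruxes.BlochSeedDiscOne.Anchor
open Summit.Ventures.HSemireg Summit.Ventures.HSemireg.Pad4Tower

/-! ## §13.1 Divided powers `h^[k] = hᵏ∕k!` and the binomial law `(b + c)^[k] = Σ_{i+j=k} b^[i] ∪ c^[j]` -/

section DividedPowers

variable (X : SchemeOver ℂ)

/-- the **divided power `h^[k] = hᵏ∕k! ∈ H^{2k}(X(ℂ); ℂ)`** of a degree-two class (the degree-`k` term of `exp h`; the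
right-hand side of law (F1) of the word frame). [cite: HatcherAT2002, §3.2] -/
def divPow (h : complexBetti X 2) (k : ℕ) : complexBetti X (2 * k) :=
  ((k.factorial : ℕ) : ℂ)⁻¹ • cupPowTwo h k

/-- `h^[0] = 1`. -/
theorem divPow_zero (h : complexBetti X 2) : divPow X h 0 = singularCohomology.one ℂ _ := by
  rw [divPow, Nat.factorial_zero, Nat.cast_one, inv_one, one_smul, cupPowTwo_zero]

/-- `h^[1] = h`. -/
theorem divPow_one (h : complexBetti X 2) : divPow X h 1 = h := by
  rw [divPow, Nat.factorial_one, Nat.cast_one, inv_one, one_smul, cupPowTwo_one]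

variable {X}

/-- naturality `g^*(h^[k]) = (g^*h)^[k]`. [cite: HatcherAT2002, Prop. 3.10] -/
theorem map_divPow {X' : SchemeOver ℂ} (g : X' ⟶ X) (h : complexBetti X 2) (k : ℕ) :
    complexBetti.map g (2 * k) (divPow X h k) = divPow X' (complexBetti.map g 2 h) k := by
  rw [divPow, divPow, map_smul, map_cupPowTwo]

/-- `0ʲ = 0` for `j ≠ 0` (cup powers of the zero class). [cite: HatcherAT2002, §3.2] -/
theorem cupPowTwo_zero_eq_zero {Y : Type} [TopologicalSpace Y] {j : ℕ} (hj : j ≠ 0) :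
    cupPowTwo (0 : singularCohomology ℂ ℂ Y 2) j = 0 := by
  obtain ⟨i, rfl⟩ := Nat.exists_eq_succ_of_ne_zero hj
  rw [cupPowTwo_succ]
  exact map_zero _

/-- `x ∪ 0ʲ = x` for `j = 0` — the degree-bookkeeping form (free index `j`) in which the term `i = k` of an exponential twist
against the unit family collapses. [cite: HatcherAT2002, §3.2 p. 211] -/
theorem cupProduct_cupPowTwo_zero_of_eq_zero {Y : Type} [TopologicalSpace Y] {n j : ℕ} (hj : j = 0) (h : n + 2 * j = n)
    (x : singularCohomology ℂ ℂ Y n) : cupProduct h x (cupPowTwo (0 : singularCohomology ℂ ℂ Y 2) j) = x := by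
  subst hj
  rw [cupPowTwo_zero]
  exact cupProduct_one x

variable (X)

/-- **`e^{a} ∪ (1, 0, 0, …) = (a^[k])_k`**: the exponential twist of the UNIT family `(0⁰, 0¹, 0², …) = (1, 0, 0, …)` is the
family of divided powers. [cite: HuybrechtsStellari2005, §1] -/
theorem expTwistClasses_cupPowTwo_zero (a : complexBetti X 2) (k : ℕ) :
    expTwistClasses X a (cupPowTwo (0 : complexBetti X 2)) k = divPow X a k := by
  unfold expTwistClasses divPow
  rw [Finset.sum_eq_single (Fin.last k)]
  · -- the surviving term `i = k`: generalise `↑(Fin.last k)` to a variable equal to `k` first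
    have main : ∀ (i : ℕ) (_ : i = k) (h : 2 * i + 2 * (k - i) = 2 * k),
        ((i.factorial : ℕ) : ℂ)⁻¹ • cupProduct h (cupPowTwo a i) (cupPowTwo (0 : complexBetti X 2) (k - i)) =
          ((k.factorial : ℕ) : ℂ)⁻¹ • cupPowTwo a k := by
      rintro i rfl h
      rw [cupProduct_cupPowTwo_zero_of_eq_zero (Nat.sub_self _)]
    exact main _ rfl _
  · intro i _ hi
    have hi' : (i : ℕ) ≠ k := fun h' => hi (Fin.ext h')
    have hik : k - (i : ℕ) ≠ 0 := by have := i.2; omega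
    rw [cupPowTwo_zero_eq_zero hik, map_zero, smul_zero]
  · intro h'
    exact absurd (Finset.mem_univ _) h'

/-- **THE BINOMIAL LAW IN DIVIDED-POWER FORM `(b + c)^[k] = Σ_{i ≤ k} b^[i] ∪ c^[k-i]`** — the tree's exponential law
`expTwistClasses_add` (`e^{b+c} ∪ κ = e^{b} ∪ (e^{c} ∪ κ)`) read against the unit family. [cite: HuybrechtsStellari2005, §1]
[cite: HatcherAT2002, §3.2 and Thm. 3.11] -/
theorem divPow_add (b c : complexBetti X 2) (k : ℕ) :
    divPow X (b + c) k =
      ∑ i : Fin (k + 1), cupProduct (two_mul_add_two_mul_sub i.2) (divPow X b i) (divPow X c (k - i)) := by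
  have hU : ∀ a : complexBetti X 2, expTwistClasses X a (cupPowTwo (0 : complexBetti X 2)) = divPow X a :=
    fun a => funext fun j => expTwistClasses_cupPowTwo_zero X a j
  rw [← hU, expTwistClasses_add, hU c]
  unfold expTwistClasses
  refine Finset.sum_congr rfl fun i _ => ?_
  simp only [divPow, map_smul, LinearMap.smul_apply, smul_smul, mul_comm]

end DividedPowers

/-! ## §13.2 Total even families and their exterior product across `B × C` -/

section Families

variable {B C : AbelianVariety ℂ}

/-- **the exterior product of two total even families** `κ = (κ_i ∈ H^{2i}(B))_i`, `ν = (ν_j ∈ H^{2j}(C))_j`: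
`(κ ⊠ ν)_k = Σ_{i ≤ k} pr₁^*κ_i ∪ pr₂^*ν_{k-i} ∈ H^{2k}((B × C)(ℂ); ℂ)` (the graded tensor product of Künneth).
[cite: HatcherAT2002, §3.2 Künneth formula, Thm. 3.15 online ed. (3.16 in print)] -/
def famCross (κ : (i : ℕ) → complexBetti B.X (2 * i)) (ν : (j : ℕ) → complexBetti C.X (2 * j)) (k : ℕ) :
    complexBetti (B.prod C).X (2 * k) :=
  ∑ i : Fin (k + 1), cupProduct (two_mul_add_two_mul_sub i.2)
    (complexBetti.map (AbelianVariety.fst B C).hom.hom.hom (2 * (i : ℕ)) (κ i))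
    (complexBetti.map (AbelianVariety.snd B C).hom.hom.hom (2 * (k - i)) (ν (k - i)))

/-- **`(h_B^[·]) ⊠ (h_C^[·]) = (pr₁^*h_B + pr₂^*h_C)^[·]`** — divided powers are exponential across a product (the binomial
law and naturality). [cite: HuybrechtsStellari2005, §1] [cite: HatcherAT2002, Prop. 3.10] -/
theorem famCross_divPow (hB : complexBetti B.X 2) (hC : complexBetti C.X 2) (k : ℕ) :
    famCross (divPow B.X hB) (divPow C.X hC) k =
      divPow (B.prod C).X (complexBetti.map (AbelianVariety.fst B C).hom.hom.hom 2 hB +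
        complexBetti.map (AbelianVariety.snd B C).hom.hom.hom 2 hC) k := by
  rw [divPow_add]
  unfold famCross
  refine Finset.sum_congr rfl fun i _ => ?_
  rw [map_divPow, map_divPow]

/-- **bilinearity**: the exterior product of two finite sums of families is the double sum of the exterior products.
[cite: HatcherAT2002, §3.2] -/
theorem famCross_sum_sum {W L : Type*} (s : Finset W) (t : Finset L)
    (κ : W → (i : ℕ) → complexBetti B.X (2 * i)) (ν : L → (j : ℕ) → complexBetti C.X (2 * j)) (k : ℕ) :
    famCross (fun i => ∑ w ∈ s, κ w i) (fun j => ∑ l ∈ t, ν l j) k = ∑ w ∈ s, ∑ l ∈ t, famCross (κ w) (ν l) k := by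
  have key : ∀ i : Fin (k + 1),
      cupProduct (two_mul_add_two_mul_sub i.2)
          (complexBetti.map (AbelianVariety.fst B C).hom.hom.hom (2 * (i : ℕ)) (∑ w ∈ s, κ w i))
          (complexBetti.map (AbelianVariety.snd B C).hom.hom.hom (2 * (k - i)) (∑ l ∈ t, ν l (k - i))) =
        ∑ w ∈ s, ∑ l ∈ t, cupProduct (two_mul_add_two_mul_sub i.2)
          (complexBetti.map (AbelianVariety.fst B C).hom.hom.hom (2 * (i : ℕ)) (κ w i))
          (complexBetti.map (AbelianVariety.snd B C).hom.hom.hom (2 * (k - i)) (ν l (k - i))) := fun i => by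
    simp only [map_sum, LinearMap.sum_apply]
    exact Finset.sum_comm
  unfold famCross
  rw [Finset.sum_congr rfl fun i _ => key i, Finset.sum_comm]
  exact Finset.sum_congr rfl fun w _ => Finset.sum_comm

/-- **vanishing by concentration**: if `κ` is concentrated in degree `a` and `ν` in degree `b`, then `κ ⊠ ν` vanishes off
degree `a + b`. [cite: HatcherAT2002, §3.2 Künneth formula, Thm. 3.15 online ed. (3.16 in print)] -/
theorem famCross_eq_zero_of_ne {κ : (i : ℕ) → complexBetti B.X (2 * i)} {ν : (j : ℕ) → complexBetti C.X (2 * j)}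
    {a b k : ℕ} (hκ : ∀ i, i ≠ a → κ i = 0) (hν : ∀ j, j ≠ b → ν j = 0) (hk : k ≠ a + b) : famCross κ ν k = 0 := by
  unfold famCross
  refine Finset.sum_eq_zero fun i _ => ?_
  by_cases hi : (i : ℕ) = a
  · have hki : k - (i : ℕ) ≠ b := by have := i.2; omega
    rw [hν _ hki, map_zero, map_zero]
  · rw [hκ _ hi, map_zero, LinearMap.map_zero₂]

/-- **vanishing by truncation**: if `κ_i = 0` for `i > a` and `ν_j = 0` for `j > b`, then `(κ ⊠ ν)_k = 0` for `k > a + b`.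
[cite: HatcherAT2002, §3.2 Künneth formula, Thm. 3.15 online ed. (3.16 in print)] -/
theorem famCross_eq_zero_of_lt {κ : (i : ℕ) → complexBetti B.X (2 * i)} {ν : (j : ℕ) → complexBetti C.X (2 * j)}
    {a b k : ℕ} (hκ : ∀ i, a < i → κ i = 0) (hν : ∀ j, b < j → ν j = 0) (hk : a + b < k) : famCross κ ν k = 0 := by
  unfold famCross
  refine Finset.sum_eq_zero fun i _ => ?_
  by_cases hi : a < (i : ℕ)
  · rw [hκ _ hi, map_zero, LinearMap.map_zero₂]
  · have hki : b < k - (i : ℕ) := by have := i.2; omega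
    rw [hν _ hki, map_zero, map_zero]

/-- **the single surviving term**: if `κ` is concentrated in degree `a = i₀`, then `(κ ⊠ ν)_k = pr₁^*κ_{i₀} ∪ pr₂^*ν_{k-i₀}`.
[cite: HatcherAT2002, §3.2 Künneth formula, Thm. 3.15 online ed. (3.16 in print)] -/
theorem famCross_single {κ : (i : ℕ) → complexBetti B.X (2 * i)} {ν : (j : ℕ) → complexBetti C.X (2 * j)} {a k : ℕ}
    (hκ : ∀ i, i ≠ a → κ i = 0) (i₀ : Fin (k + 1)) (ha : (i₀ : ℕ) = a) :
    famCross κ ν k = cupProduct (two_mul_add_two_mul_sub i₀.2)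
      (complexBetti.map (AbelianVariety.fst B C).hom.hom.hom (2 * (i₀ : ℕ)) (κ i₀))
      (complexBetti.map (AbelianVariety.snd B C).hom.hom.hom (2 * (k - i₀)) (ν (k - i₀))) := by
  unfold famCross
  refine Finset.sum_eq_single i₀ (fun i _ hi => ?_) fun h' => absurd (Finset.mem_univ _) h'
  have hi' : (i : ℕ) ≠ a := fun h' => hi (Fin.ext (h'.trans ha.symm))
  rw [hκ _ hi', map_zero, LinearMap.map_zero₂]

/-- `(κ ⊠ ν)_0 = pr₁^*κ_0 ∪ pr₂^*ν_0`. -/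
theorem famCross_apply_zero (κ : (i : ℕ) → complexBetti B.X (2 * i)) (ν : (j : ℕ) → complexBetti C.X (2 * j)) :
    famCross κ ν 0 = cupProduct (show 2 * 0 + 2 * 0 = 2 * 0 from rfl)
      (complexBetti.map (AbelianVariety.fst B C).hom.hom.hom (2 * 0) (κ 0))
      (complexBetti.map (AbelianVariety.snd B C).hom.hom.hom (2 * 0) (ν 0)) := by
  unfold famCross
  rw [Fin.sum_univ_one]
  rfl

/-- `(κ ⊠ ν)_1 = pr₁^*κ_0 ∪ pr₂^*ν_1 + pr₁^*κ_1 ∪ pr₂^*ν_0`. -/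
theorem famCross_apply_one (κ : (i : ℕ) → complexBetti B.X (2 * i)) (ν : (j : ℕ) → complexBetti C.X (2 * j)) :
    famCross κ ν 1 =
      cupProduct (show 2 * 0 + 2 * 1 = 2 * 1 from rfl)
          (complexBetti.map (AbelianVariety.fst B C).hom.hom.hom (2 * 0) (κ 0))
          (complexBetti.map (AbelianVariety.snd B C).hom.hom.hom (2 * 1) (ν 1)) +
        cupProduct (show 2 * 1 + 2 * 0 = 2 * 1 from rfl)
          (complexBetti.map (AbelianVariety.fst B C).hom.hom.hom (2 * 1) (κ 1))
          (complexBetti.map (AbelianVariety.snd B C).hom.hom.hom (2 * 0) (ν 0)) := by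
  unfold famCross
  rw [Fin.sum_univ_two]
  rfl

/-- `(κ ⊠ ν)_2 = pr₁^*κ_0 ∪ pr₂^*ν_2 + pr₁^*κ_1 ∪ pr₂^*ν_1 + pr₁^*κ_2 ∪ pr₂^*ν_0`. -/
theorem famCross_apply_two (κ : (i : ℕ) → complexBetti B.X (2 * i)) (ν : (j : ℕ) → complexBetti C.X (2 * j)) :
    famCross κ ν 2 =
      cupProduct (show 2 * 0 + 2 * 2 = 2 * 2 from rfl)
          (complexBetti.map (AbelianVariety.fst B C).hom.hom.hom (2 * 0) (κ 0))
          (complexBetti.map (AbelianVariety.snd B C).hom.hom.hom (2 * 2) (ν 2)) +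
        cupProduct (show 2 * 1 + 2 * 1 = 2 * 2 from rfl)
          (complexBetti.map (AbelianVariety.fst B C).hom.hom.hom (2 * 1) (κ 1))
          (complexBetti.map (AbelianVariety.snd B C).hom.hom.hom (2 * 1) (ν 1)) +
        cupProduct (show 2 * 2 + 2 * 0 = 2 * 2 from rfl)
          (complexBetti.map (AbelianVariety.fst B C).hom.hom.hom (2 * 2) (κ 2))
          (complexBetti.map (AbelianVariety.snd B C).hom.hom.hom (2 * 0) (ν 0)) := by
  unfold famCross
  rw [Fin.sum_univ_three]
  rfl

end Families

/-! ## §13.3 The letters `1, u, v, e, ē, p` on the Weil surface `S = E₀ × E₀` and the law `Σ_{e-free} = h_S^[·]` -/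

section Letters

variable {E₀ : AbelianVariety ℂ} (η : complexBetti E₀.X 2) (e ebar : complexBetti (weilSurf E₀).X (2 * 1))

/-- the letter **`u = pr₁^*η ∈ H²(S(ℂ); ℂ)`** (`η` the generator of `H²(E₀(ℂ))`; pad4lib letter `u`, degree `1`). -/
def uLetter : complexBetti (weilSurf E₀).X (2 * 1) := complexBetti.map (AbelianVariety.fst E₀ E₀).hom.hom.hom 2 η

/-- the letter **`v = pr₂^*η`** (pad4lib letter `v`, degree `1`). -/
def vLetter : complexBetti (weilSurf E₀).X (2 * 1) := complexBetti.map (AbelianVariety.snd E₀ E₀).hom.hom.hom 2 η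

/-- the letter **`p = u ∪ v ∈ H⁴(S(ℂ); ℂ)`** (the point class of `S`; pad4lib letter `p`, degree `2`). -/
def pLetter : complexBetti (weilSurf E₀).X (2 * 2) :=
  cupProduct (show 2 * 1 + 2 * 1 = 2 * 2 from rfl) (uLetter η) (vLetter η)

/-- **THE LETTER FAMILIES** `ℓ(l) = (ℓ(l)_j)_j`, `l ∈ {0,…,5} = {1, u, v, e, ē, p}` (pad4lib `LETTERS`, `DEG = [0,1,1,1,1,2]`):
the class of the letter placed in its degree `ldeg l`, zero in every other degree; the two degree-one letters `e, ē` are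
PARAMETERS (to be instantiated with an `H¹`-eigenframe's `e = pr₁^*x⁺ ∪ pr₂^*x⁻`, `ē`, cf. `SeedCheckerFrame.lean` §10.3). -/
def letterFam (l : Fin 6) : (j : ℕ) → complexBetti (weilSurf E₀).X (2 * j)
  | 0 => if l = 0 then singularCohomology.one ℂ _ else 0
  | 1 => ![0, uLetter η, vLetter η, e, ebar, 0] l
  | 2 => if l = 5 then pLetter η else 0
  | _ + 3 => 0

theorem letterFam_zero_zero : letterFam η e ebar 0 0 = singularCohomology.one ℂ _ := by simp [letterFam]
theorem letterFam_one_one : letterFam η e ebar 1 1 = uLetter η := rfl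
theorem letterFam_two_one : letterFam η e ebar 2 1 = vLetter η := rfl
theorem letterFam_three_one : letterFam η e ebar 3 1 = e := rfl
theorem letterFam_four_one : letterFam η e ebar 4 1 = ebar := rfl
theorem letterFam_five_two : letterFam η e ebar 5 2 = pLetter η := by simp [letterFam]

/-- **each letter family is concentrated in its degree `ldeg l`.** -/
theorem letterFam_eq_zero (l : Fin 6) : ∀ {j : ℕ}, j ≠ ldeg l → letterFam η e ebar l j = 0
  | 0, hj => by
    have hl : l ≠ 0 := by
      rintro rfl
      exact hj rfl
    exact if_neg hl
  | 1, hj => by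
    fin_cases l <;> first | rfl | exact absurd rfl hj
  | 2, hj => by
    fin_cases l <;> first | exact absurd rfl hj | simp +decide [letterFam]
  | _ + 3, _ => rfl

/-- a sum over the **e-free letters** (not `e = 3`, not `ē = 4`: the per-factor clause of `Pad4Tower.EFree`) is the sum
over `1, u, v, p`. -/
theorem sum_lfree {M : Type*} [AddCommMonoid M] (g : Fin 6 → M) :
    ∑ l ∈ Finset.univ.filter (fun l : Fin 6 => l ≠ 3 ∧ l ≠ 4), g l = g 0 + g 1 + g 2 + g 5 := by
  rw [Finset.sum_filter, Fin.sum_univ_six]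
  simp +decide

/-- on a CURVE `E₀` the divided powers `η^[i]`, `i ≥ 2`, vanish (`H^{2i}(E₀(ℂ)) = 0` above the top degree `2`).
(tree: `subsingleton_complexBetti`) [cite: HatcherAT2002, §3.3] -/
theorem divPow_eq_zero_of_dim_one (hE : E₀.dim = 1) (i : ℕ) (hi : 1 < i) : divPow E₀.X η i = 0 :=
  haveI := subsingleton_complexBetti (isSmoothProjective_of_dim_eq' hE) (show 2 * 1 < 2 * i by omega)
  Subsingleton.elim _ _

/-- **THE LETTER LAW ON `S` (level one of (F1))**: `Σ_{l e-free} ℓ(l)_j = h_S^[j]` for every `j`, `h_S = u + v` — i.e.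
`exp(h_S) = 1 + (u + v) + p`: `u² = v² = 0` (`η² = 0` on a curve), `uv = vu = p`, `h_S³ = 0`. Proof: `h_S^[·] = η^[·] ⊠ η^[·]`
(`famCross_divPow`) with `η^[·] = (1, η, 0, …)`.
[cite: HatcherAT2002, §3.2 Künneth formula, Thm. 3.15 online ed. (3.16 in print)] [cite: vanGeemen1994HodgeAV, proof of Thm. 6.12] -/
theorem sum_letterFam (hE : E₀.dim = 1) (j : ℕ) :
    ∑ l ∈ Finset.univ.filter (fun l : Fin 6 => l ≠ 3 ∧ l ≠ 4), letterFam η e ebar l j =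
      divPow (weilSurf E₀).X (hSurf E₀ η) j := by
  have h2 : ∀ i, 1 < i → divPow E₀.X η i = 0 := divPow_eq_zero_of_dim_one η hE
  rw [sum_lfree, show hSurf E₀ η = complexBetti.map (AbelianVariety.fst E₀ E₀).hom.hom.hom 2 η +
    complexBetti.map (AbelianVariety.snd E₀ E₀).hom.hom.hom 2 η from rfl, ← famCross_divPow]
  match j with
  | 0 =>
    rw [famCross_apply_zero, divPow_zero, singularCohomology.map_one, singularCohomology.map_one, one_cupProduct,
      letterFam_eq_zero η e ebar 1 (j := 0) (by decide), letterFam_eq_zero η e ebar 2 (j := 0) (by decide),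
      letterFam_eq_zero η e ebar 5 (j := 0) (by decide), add_zero, add_zero, add_zero]
    exact letterFam_zero_zero η e ebar
  | 1 =>
    rw [famCross_apply_one, divPow_zero, divPow_one, singularCohomology.map_one, singularCohomology.map_one,
      one_cupProduct, cupProduct_one, letterFam_one_one, letterFam_two_one,
      letterFam_eq_zero η e ebar 0 (j := 1) (by decide), letterFam_eq_zero η e ebar 5 (j := 1) (by decide),
      zero_add, add_zero]
    exact add_comm _ _
  | 2 =>
    rw [famCross_apply_two, divPow_one, h2 2 one_lt_two, map_zero, map_zero, map_zero, LinearMap.map_zero₂, zero_add,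
      add_zero, letterFam_five_two, letterFam_eq_zero η e ebar 0 (j := 2) (by decide),
      letterFam_eq_zero η e ebar 1 (j := 2) (by decide), letterFam_eq_zero η e ebar 2 (j := 2) (by decide),
      zero_add, zero_add, zero_add]
    rfl
  | n + 3 =>
    rw [famCross_eq_zero_of_lt (a := 1) (b := 1) h2 h2 (by omega)]
    simp only [show ∀ l : Fin 6, letterFam η e ebar l (n + 3) = 0 from fun _ => rfl, add_zero]

end Letters

/-! ## §13.4 The word frame on `S⁴ = ((S × S) × S) × S`: construction and law (F1) -/

section Tower

variable {E₀ : AbelianVariety ℂ} (η : complexBetti E₀.X 2) (e ebar : complexBetti (weilSurf E₀).X (2 * 1))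

/-- level 1: the word class of a one-letter word on `S`. -/
def frameCls1 (w : Fin 1 → Fin 6) : (p : ℕ) → complexBetti (weilSurf E₀).X (2 * p) := letterFam η e ebar (w 0)

/-- level 2: `cls(w₀ w₁) = cls(w₀) ⊠ ℓ(w₁)` on `S² = pad2Anchor E₀`. -/
def frameCls2 (w : Fin 2 → Fin 6) : (p : ℕ) → complexBetti (pad2Anchor E₀).X (2 * p) :=
  famCross (frameCls1 η e ebar (Fin.init w)) (letterFam η e ebar (w (Fin.last 1)))

/-- level 3: `cls(w₀ w₁ w₂) = cls(w₀ w₁) ⊠ ℓ(w₂)` on `S³ = pad3Anchor E₀`. -/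
def frameCls3 (w : Fin 3 → Fin 6) : (p : ℕ) → complexBetti (pad3Anchor E₀).X (2 * p) :=
  famCross (frameCls2 η e ebar (Fin.init w)) (letterFam η e ebar (w (Fin.last 2)))

/-- level 4: **the word class `cls(w) = ℓ(w₀) ⊠ ℓ(w₁) ⊠ ℓ(w₂) ⊠ ℓ(w₃)`** of a word `w : CWord` on `S⁴ = pad4Anchor E₀`, nested
EXACTLY as `pad4Anchor E₀ = ((S × S) × S) × S`, as a total even family (concentrated in degree `wdeg w`). -/
def frameCls4 (w : CWord) : (p : ℕ) → complexBetti (pad4Anchor E₀).X (2 * p) :=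
  famCross (frameCls3 η e ebar (Fin.init w)) (letterFam η e ebar (w (Fin.last 3)))

/-- concentration, level 1. -/
theorem frameCls1_eq_zero (w : Fin 1 → Fin 6) {p : ℕ} (hp : p ≠ ldeg (w 0)) : frameCls1 η e ebar w p = 0 :=
  letterFam_eq_zero η e ebar (w 0) hp

/-- concentration, level 2. -/
theorem frameCls2_eq_zero (w : Fin 2 → Fin 6) {p : ℕ} (hp : p ≠ ldeg (w 0) + ldeg (w 1)) :
    frameCls2 η e ebar w p = 0 :=
  famCross_eq_zero_of_ne (fun _ hi => frameCls1_eq_zero η e ebar _ hi) (fun _ hj => letterFam_eq_zero η e ebar _ hj) hp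

/-- concentration, level 3. -/
theorem frameCls3_eq_zero (w : Fin 3 → Fin 6) {p : ℕ} (hp : p ≠ ldeg (w 0) + ldeg (w 1) + ldeg (w 2)) :
    frameCls3 η e ebar w p = 0 :=
  famCross_eq_zero_of_ne (fun _ hi => frameCls2_eq_zero η e ebar _ hi) (fun _ hj => letterFam_eq_zero η e ebar _ hj) hp

/-- **the word class `cls(w)` is concentrated in degree `wdeg w`.** -/
theorem frameCls4_eq_zero (w : CWord) {p : ℕ} (hp : p ≠ wdeg w) : frameCls4 η e ebar w p = 0 :=
  famCross_eq_zero_of_ne (fun _ hi => frameCls3_eq_zero η e ebar _ hi) (fun _ hj => letterFam_eq_zero η e ebar _ hj) hp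

variable {η e ebar}

/-- **THE TOWER STEP**: if the e-free word classes on `B` (words on `m + 1` factors) sum, degree by degree, to `h_B^[·]`,
then the e-free word classes `cls(w') ⊠ ℓ(l)` on `B × S` sum to `(pr₁^*h_B + pr₂^*h_S)^[·]` — reindex words on `m + 2`
factors as (word, last letter), bilinearity, the letter law on `S`, and `h_B^[·] ⊠ h_S^[·] = (pr₁^*h_B + pr₂^*h_S)^[·]`.
[cite: HatcherAT2002, §3.2 Künneth formula, Thm. 3.15 online ed. (3.16 in print)] -/
theorem tower_step (hE : E₀.dim = 1) {B : AbelianVariety ℂ} {m : ℕ}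
    (clsB : (Fin (m + 1) → Fin 6) → (i : ℕ) → complexBetti B.X (2 * i)) (hB : complexBetti B.X 2)
    (law : ∀ i, ∑ w ∈ Finset.univ.filter (fun w : Fin (m + 1) → Fin 6 => ∀ f, w f ≠ 3 ∧ w f ≠ 4), clsB w i =
      divPow B.X hB i) (p : ℕ) :
    ∑ w ∈ Finset.univ.filter (fun w : Fin (m + 2) → Fin 6 => ∀ f, w f ≠ 3 ∧ w f ≠ 4),
        famCross (clsB (Fin.init w)) (letterFam η e ebar (w (Fin.last (m + 1)))) p =
      divPow (B.prod (weilSurf E₀)).X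
        (complexBetti.map (AbelianVariety.fst B (weilSurf E₀)).hom.hom.hom 2 hB +
          complexBetti.map (AbelianVariety.snd B (weilSurf E₀)).hom.hom.hom 2 (hSurf E₀ η)) p := by
  have h1 : ∑ w ∈ Finset.univ.filter (fun w : Fin (m + 2) → Fin 6 => ∀ f, w f ≠ 3 ∧ w f ≠ 4),
        famCross (clsB (Fin.init w)) (letterFam η e ebar (w (Fin.last (m + 1)))) p =
      ∑ x ∈ Finset.univ.filter (fun w : Fin (m + 1) → Fin 6 => ∀ f, w f ≠ 3 ∧ w f ≠ 4) ×ˢ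
          Finset.univ.filter (fun l : Fin 6 => l ≠ 3 ∧ l ≠ 4), famCross (clsB x.1) (letterFam η e ebar x.2) p := by
    refine Finset.sum_equiv ((Fin.snocEquiv fun _ => Fin 6).symm.trans (Equiv.prodComm _ _)) (fun w => ?_)
      (fun w _ => rfl)
    simp only [Finset.mem_filter, Finset.mem_univ, true_and, Finset.mem_product, Equiv.trans_apply,
      Fin.snocEquiv_symm_apply, Equiv.prodComm_apply, Prod.swap_prod_mk, Fin.forall_fin_succ']
    exact Iff.rfl
  have hlaw : (fun i => ∑ w ∈ Finset.univ.filter (fun w : Fin (m + 1) → Fin 6 => ∀ f, w f ≠ 3 ∧ w f ≠ 4), clsB w i) =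
      divPow B.X hB := funext law
  have hS : (fun j => ∑ l ∈ Finset.univ.filter (fun l : Fin 6 => l ≠ 3 ∧ l ≠ 4), letterFam η e ebar l j) =
      divPow (weilSurf E₀).X (hSurf E₀ η) := funext (sum_letterFam η e ebar hE)
  rw [h1, Finset.sum_product, ← famCross_sum_sum, hlaw, hS, famCross_divPow]

variable (η e ebar)

/-- (F1), level 1: the letter law, reindexed by one-letter words. -/
theorem frameCls1_law (hE : E₀.dim = 1) (p : ℕ) :
    ∑ w ∈ Finset.univ.filter (fun w : Fin 1 → Fin 6 => ∀ f, w f ≠ 3 ∧ w f ≠ 4), frameCls1 η e ebar w p =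
      divPow (weilSurf E₀).X (hSurf E₀ η) p := by
  rw [← sum_letterFam η e ebar hE p]
  refine Finset.sum_equiv (Equiv.funUnique (Fin 1) (Fin 6)) (fun w => ?_) (fun w _ => rfl)
  simp only [Finset.mem_filter, Finset.mem_univ, true_and, Equiv.funUnique_apply, Fin.forall_fin_one,
    Fin.default_eq_zero]

/-- (F1), level 2. -/
theorem frameCls2_law (hE : E₀.dim = 1) (p : ℕ) :
    ∑ w ∈ Finset.univ.filter (fun w : Fin 2 → Fin 6 => ∀ f, w f ≠ 3 ∧ w f ≠ 4), frameCls2 η e ebar w p =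
      divPow (pad2Anchor E₀).X (hPad2 E₀ η) p :=
  tower_step hE (frameCls1 η e ebar) (hSurf E₀ η) (frameCls1_law η e ebar hE) p

/-- (F1), level 3. -/
theorem frameCls3_law (hE : E₀.dim = 1) (p : ℕ) :
    ∑ w ∈ Finset.univ.filter (fun w : Fin 3 → Fin 6 => ∀ f, w f ≠ 3 ∧ w f ≠ 4), frameCls3 η e ebar w p =
      divPow (pad3Anchor E₀).X (hPad3 E₀ η) p :=
  tower_step hE (frameCls2 η e ebar) (hPad2 E₀ η) (frameCls2_law η e ebar hE) p

/-- **(F1), level 4: `Σ_{w e-free} cls(w)_p = h_std^[p]`** on `S⁴` (all e-free words; those of degree `≠ p` contribute `0`). -/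
theorem frameCls4_law (hE : E₀.dim = 1) (p : ℕ) :
    ∑ w ∈ Finset.univ.filter (fun w : CWord => EFree w), frameCls4 η e ebar w p =
      divPow (pad4Anchor E₀).X (hStd E₀ η) p :=
  tower_step hE (frameCls3 η e ebar) (hPad3 E₀ η) (frameCls3_law η e ebar hE) p

/-- **THE WORD FRAME OF THE ANCHOR `S⁴` (obligation O-WF, CONSTRUCTED)**: `cls p w = (ℓ(w₀) ⊠ ℓ(w₁) ⊠ ℓ(w₂) ⊠ ℓ(w₃))_p`, an
instance of v4 §6.2 `WordFrame E₀`, for the letters `1, u = pr₁^*η, v = pr₂^*η, p = uv` and two parameter letters `e, ē`. -/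
def wordFrameOf : WordFrame E₀ :=
  ⟨fun p w => frameCls4 η e ebar w p⟩

theorem wordFrameOf_cls (p : ℕ) (w : CWord) : (wordFrameOf η e ebar).cls p w = frameCls4 η e ebar w p := rfl

/-- **LAW (F1) OF THE WORD FRAME, PROVED**: `Σ_{w e-free, wdeg w = p} cls p w = h_std^p ∕ p!` for `p ≤ 8`, `h_std` the frame's
polarisation `Σ_f (u_f + v_f)` of v4 §2 — literally the field `WordFrame.LinksTo.sum_eFree`.
[cite: HatcherAT2002, §3.2 Künneth formula, Thm. 3.15 online ed. (3.16 in print)] -/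
theorem wordFrameOf_sum_eFree (hE : E₀.dim = 1) (p : Fin 9) :
    ∑ w ∈ eFreeWordsOfDeg p, (wordFrameOf η e ebar).cls p w =
      (((p : ℕ).factorial : ℕ) : ℂ)⁻¹ • cupPowTwo (hStd E₀ η) p := by
  show ∑ w ∈ eFreeWordsOfDeg p, frameCls4 η e ebar w p = divPow (pad4Anchor E₀).X (hStd E₀ η) p
  rw [← frameCls4_law η e ebar hE p]
  refine Finset.sum_subset (fun w hw => ?_) (fun w hw hw' => ?_)
  · exact Finset.mem_filter.2 ⟨Finset.mem_univ _, (mem_eFreeWordsOfDeg.1 hw).2⟩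
  · have hd : wdeg w ≠ p := fun h' => hw' (mem_eFreeWordsOfDeg.2 ⟨h', (Finset.mem_filter.1 hw).2⟩)
    exact frameCls4_eq_zero η e ebar w (Ne.symm hd)

end Tower

/-! ## §13.5 The two e-words: `cls 4 eeee = e ⊠ e ⊠ e ⊠ e`, `cls 4 ēēēē = ē ⊠ ē ⊠ ē ⊠ ē` (the (F2) side) -/

section EWords

variable {E₀ : AbelianVariety ℂ} {B : AbelianVariety ℂ}

/-- **one step `b ⊠ c = pr₁^*b ∪ pr₂^*c ∈ H^{2(n+1)}((B × S)(ℂ))`** of the nested tower — VERBATIM the definition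
`SeedCheckerFrame.cross` of v7.1 §10.4 (not importable from here: its farm snapshot is unbuilt), under a new name; in a file
importing both, `xstep b c = cross b c` is `rfl`.
[cite: HatcherAT2002, §3.2 Künneth formula, Thm. 3.15 online ed. (3.16 in print)] -/
def xstep {n : ℕ} (b : complexBetti B.X (2 * n)) (c : complexBetti (weilSurf E₀).X (2 * 1)) :
    complexBetti (B.prod (weilSurf E₀)).X (2 * (n + 1)) :=
  cupProduct (two_mul_add_two_mul n 1)
    (complexBetti.map (AbelianVariety.fst B (weilSurf E₀)).hom.hom.hom (2 * n) b)
    (complexBetti.map (AbelianVariety.snd B (weilSurf E₀)).hom.hom.hom (2 * 1) c)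

/-- **`c ⊠ c ⊠ c ⊠ c ∈ H⁸(S⁴(ℂ); ℂ)`** nested as `pad4Anchor E₀` — for `c = eLetter ψ₀ v` this is `SeedCheckerFrame.eeee ψ₀ v`
(v7.1 §10.4) BY `rfl`, for `c = ebarLetter ψ₀ v` it is `eeeeBar ψ₀ v`. -/
def eeeeOf (c : complexBetti (weilSurf E₀).X (2 * 1)) : complexBetti (pad4Anchor E₀).X (2 * 4) :=
  xstep (xstep (xstep c c) c) c

variable (η : complexBetti E₀.X 2) (e ebar : complexBetti (weilSurf E₀).X (2 * 1))

/-- `cls(ee)_2 = e ⊠ e` on `S²`. -/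
theorem frameCls2_ee : frameCls2 η e ebar (Fin.init (Fin.init eWord)) 2 = xstep e e :=
  (famCross_single (fun _ hi => letterFam_eq_zero η e ebar 3 hi) ⟨1, by omega⟩ rfl).trans rfl

/-- `cls(eee)_3 = e ⊠ e ⊠ e` on `S³`. -/
theorem frameCls3_eee : frameCls3 η e ebar (Fin.init eWord) 3 = xstep (xstep e e) e := by
  rw [show frameCls3 η e ebar (Fin.init eWord) 3 = xstep (frameCls2 η e ebar (Fin.init (Fin.init eWord)) 2) e from
    (famCross_single (fun _ hi => frameCls2_eq_zero η e ebar _ hi) ⟨2, by omega⟩ rfl).trans rfl, frameCls2_ee]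

/-- **`cls 4 eeee = e ⊠ e ⊠ e ⊠ e`.** -/
theorem frameCls4_eWord : frameCls4 η e ebar eWord 4 = eeeeOf e := by
  rw [show frameCls4 η e ebar eWord 4 = xstep (frameCls3 η e ebar (Fin.init eWord) 3) e from
    (famCross_single (fun _ hi => frameCls3_eq_zero η e ebar _ hi) ⟨3, by omega⟩ rfl).trans rfl, frameCls3_eee]
  rfl

/-- `cls(ēē)_2 = ē ⊠ ē`. -/
theorem frameCls2_ebarebar : frameCls2 η e ebar (Fin.init (Fin.init ebarWord)) 2 = xstep ebar ebar :=
  (famCross_single (fun _ hi => letterFam_eq_zero η e ebar 4 hi) ⟨1, by omega⟩ rfl).trans rfl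

/-- `cls(ēēē)_3 = ē ⊠ ē ⊠ ē`. -/
theorem frameCls3_ebarebarebar : frameCls3 η e ebar (Fin.init ebarWord) 3 = xstep (xstep ebar ebar) ebar := by
  rw [show frameCls3 η e ebar (Fin.init ebarWord) 3 = xstep (frameCls2 η e ebar (Fin.init (Fin.init ebarWord)) 2) ebar
    from (famCross_single (fun _ hi => frameCls2_eq_zero η e ebar _ hi) ⟨2, by omega⟩ rfl).trans rfl,
    frameCls2_ebarebar]

/-- **`cls 4 ēēēē = ē ⊠ ē ⊠ ē ⊠ ē`.** -/
theorem frameCls4_ebarWord : frameCls4 η e ebar ebarWord 4 = eeeeOf ebar := by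
  rw [show frameCls4 η e ebar ebarWord 4 = xstep (frameCls3 η e ebar (Fin.init ebarWord) 3) ebar from
    (famCross_single (fun _ hi => frameCls3_eq_zero η e ebar _ hi) ⟨3, by omega⟩ rfl).trans rfl, frameCls3_ebarebarebar]
  rfl

theorem wordFrameOf_cls_eWord : (wordFrameOf η e ebar).cls 4 eWord = eeeeOf e := frameCls4_eWord η e ebar

theorem wordFrameOf_cls_ebarWord : (wordFrameOf η e ebar).cls 4 ebarWord = eeeeOf ebar := frameCls4_ebarWord η e ebar

/-- **THE WORD FRAME IS LINKED (v4 §6.2 `WordFrame.LinksTo`) to every Weil frame whose `(r₁, r₂)` is the `(e, ē)`-dictionary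
`r₁ = e⊠e⊠e⊠e + ē⊠ē⊠ē⊠ē`, `r₂ = i·(e⊠e⊠e⊠e − ē⊠ē⊠ē⊠ē)`**, with `h = h_std`: (F1) is `wordFrameOf_sum_eFree`, (F2) is the hypothesis.
With v7.1's `e = eLetter ψ₀ v`, `ē = ebarLetter ψ₀ v`, `F = normalisedFrame hE hψ hv hv0` both hypotheses are
`normalisedFrame_rOne ∕ _rTwo` (`eeeeOf (eLetter ψ₀ v) = eeee ψ₀ v` by `rfl`): obligation O-WF is then DISCHARGED. -/
theorem wordFrameOf_linksTo (hE : E₀.dim = 1) {ψ₀ : E₀ ⟶ E₀} (F : WeilFrame E₀ ψ₀)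
    (h₁ : F.rOne = eeeeOf e + eeeeOf ebar) (h₂ : F.rTwo = Complex.I • (eeeeOf e - eeeeOf ebar)) :
    (wordFrameOf η e ebar).LinksTo F (hStd E₀ η) :=
  ⟨wordFrameOf_sum_eFree η e ebar hE, by rw [wordFrameOf_cls_eWord, wordFrameOf_cls_ebarWord]; exact h₁,
    by rw [wordFrameOf_cls_eWord, wordFrameOf_cls_ebarWord]; exact h₂⟩

end EWords

end Summit.HodgeConjecture.HodgeConjecture.Cruxes.BlochSeedDiscOne.SeedChecker

end
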